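import Summits.SmoothPoincare4.SmoothPoincare4.Theorems.EntropyRungChangGurskyYangStubCurvatureRatioAux
import Summits.SmoothPoincare4.SmoothPoincare4.Theorems.EntropyRungChangGurskyYangStubLimitRound
import Literature.Geometry.Riemannian.RicciFlowSpatialRicciBounds
import Literature.Geometry.Riemannian.RicciFlowShortTimeProofs
import Literature.Geometry.Riemannian.CurvatureNormSq
import Literature.Geometry.Riemannian.RicciFlowMaximal
import Literature.Geometry.Riemannian.ChangGurskyYangRegularity
import Literature.Geometry.Riemannian.LipschitzSmoothing
import HarnessLib

/-!
# `R_max / R_min → 1` at the singular time of a pinched maximal Ricci flow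
(stub `stub_curvatureRatio` of line `margerin-cone-hamilton-rails`, crux
`EntropyRung.ChangGurskyYang`, item stmt-SmoothPoincare4-10834)

Step 4.B2 of STUB 4 (`stub_pinchedFlowConvergence` = Hamilton 1986, §5.2) of the line: **Hamilton
1982, Thm. 15.1** ("`R_max/R_min → 1` as `t → T`"; Huisken 1985, end of §4) for a maximal Ricci flow
`(g, cov)` on `[0, T)` (`IsMaximalRicciFlow`, `T < ∞`) on a closed connected 4-manifold whose
curvature is pinched, `m ≤ R` and `|W|² + 2|E|² ≤ K R^{2−τ}` (`0 < τ ≤ 1`), and which satisfies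
the gradient estimate (Hamilton 1982, Thm. 11.1: `∀ η > 0 ∃ C, |∇R|² ≤ η R³ + C`): for every
`θ < 1`, `R(x, t) ≥ θ R(y, t)` for all `x, y` at all late times.

## Proof (fact-free; Hamilton 1982, p. 299)

* `ricci_ge_of_pinching` — with `Rc(w, w) ≥ (R/4 − |E|) g(w, w)` (`sub_sqrt_mul_val_le_ricci` of the
  Aux file, Cauchy–Schwarz for the metric square norm) and the pinching
  `2|E|² ≤ K R^{2−τ} ≤ R²/32` at points with `R ≥ R_* := (32 K)^{1/τ}`: `Rc ≥ (R/8) g` there.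
* `curvNormSqWith_le_of_pinching`, `exists_lt_scalarCurvatureWith` — `R_max(t) → ∞`:
  `|Rm|² = |W|² + 2|E|² + R²/6 ≤ (K + 1/6) R² + K` (`curvNormSqWith_eq_weyl_add_traceless_add`,
  `R^{2−τ} ≤ R² + 1`), so the curvature blow-up at the maximal time (tree THEOREM
  `ricciFlow_curvature_blowup_of_shortTime ricciFlow_shortTime_existence_holds`, Topping 2006,
  Thm. 5.3.1, with `curvatureBoundedBy_of_curvNormSqWith_le`) forces `R` to exceed any level
  somewhere at every late time.
* `stub_curvatureRatio` — for `θ ∈ (0, 1)` take `η' = min (1 − θ) (1/30)` (so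
  `π² · 3 · η'² < (1/8)(1 − η')`), `η = η'⁴/2` in the gradient estimate, and `t₀` so late that
  `R_max(t) ≥ L := 1 + (2|C|/η'⁴ + 1) + R_*/(1 − η')`; then `|∇R|² ≤ η R³ + C ≤ η'⁴ R_max³`
  (`abs_mvfderiv_le_sqrt_gradSq_mul_sqrt`), `Rc ≥ (R/8) g` wherever `R ≥ (1 − η') R_max ≥ R_*`, and
  Hamilton's geometric step with the LOCALISED Ricci hypothesis (`helper_curvatureRatio_localMyers`
  of the Aux file = the tree's `one_sub_mul_le_of_ricci_ge_of_mfderiv_le`, Hopf–Rinow + Myers, with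
  `Rc ≥ ε R g` only required where `R ≥ (1 − η') R_max`) at the maximum point `x_t` of `R(·, t)`
  (compactness) gives `R ≥ (1 − η') R_max ≥ θ R_max` everywhere.

Dictionary: `R = scalarCurvatureWith (cov t) = scalarCurvature (g t)` (`cov t` is Levi-Civita,
`IsLeviCivita.ricci_eq_ricci`); `|E|² = tracelessRicciNormSq`, `|W|² = weylNormSq`,
`|Rm|² = curvNormSqWith`, `|∇R|² = gradSq`. No definition, no named fact is introduced.

## References

* R. S. Hamilton, *Three-manifolds with positive Ricci curvature*, J. Differential Geom. 17 (1982)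
  255–306, §15, Thm. 15.1 and Thm. 15.2 (p. 299); §11, Thm. 11.1; §14, Thm. 14.1. [Hamilton1982]
* G. Huisken, *Ricci deformation of the metric on a Riemannian manifold*, J. Differential Geom. 21
  (1985) 47–62, §4, p. 61. [Huisken1985]
* R. S. Hamilton, *Four-manifolds with positive curvature operator*, J. Differential Geom. 24
  (1986) 153–179, §5, 5.2 (p. 164). [Hamilton1986]
* P. Topping, *Lectures on the Ricci flow*, LMS Lecture Note Series 325 (2006), Thm. 5.3.1;
  §3.2, p. 37. [Topping2006]
-/

noncomputable section

-- every `Summit.SmoothPoincare4.SmoothPoincare4.…` name repeats the summit = sub-problem segment (D-0017 layout)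
set_option linter.dupNamespace false

open Set Function Filter Module
open scoped Manifold ContDiff Topology

namespace Summit.SmoothPoincare4.SmoothPoincare4.Theorems.MargerinRails

open Literature.Geometry.Riemannian
open Literature.Geometry.Lorentzian Literature.Geometry.Lorentzian.PseudoRiemannianMetric

/-! ## The flow on a closed 4-manifold: pinching consequences and `R_max → ∞` -/

section Four

variable {M : Type} [TopologicalSpace M] [ChartedSpace (EuclideanSpace ℝ (Fin 4)) M]
  [IsManifold (𝓡 4) ∞ M]

/-- **Pinching makes `Rc ≥ (R/8) g` where `R` is large**: for a Riemannian metric on a `4`-manifold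
with `|W|² + 2|E|² ≤ K R^{2−τ}` at `x` (`K, τ > 0`) and `R(x) ≥ R_* := (32K)^{1/τ}`, one has
`K R^{2−τ} = K R²/R^τ ≤ R²/32`, so `|E|² ≤ R²/64`, `|E| ≤ R/8`, and `Rc ≥ (R/4 − |E|) g ≥ (R/8) g`
(`sub_sqrt_mul_val_le_ricci`). [cite: Hamilton1982, §15, Thm. 15.1 (proof)] [cite: Huisken1985, §4, p. 61] -/
theorem ricci_ge_of_pinching
    (G : PseudoRiemannianMetric (𝓡 4) ∞ (EuclideanSpace ℝ (Fin 4)) (TangentSpace (𝓡 4) : M → Type _))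
    [G.HasLeviCivita] (hG : G.IsRiemannian) {K τ : ℝ} (hK : 0 < K) (hτ : 0 < τ) {x : M}
    (hpin : G.weylNormSq x + 2 * G.tracelessRicciNormSq x ≤ K * G.scalarCurvature x ^ (2 - τ))
    (hlarge : (32 * K) ^ τ⁻¹ ≤ G.scalarCurvature x) (w : TangentSpace (𝓡 4) x) :
    1 / 8 * G.scalarCurvature x * G.val x w w ≤ G.ricci x w w := by
  set S := G.scalarCurvature x with hS
  have hstar0 : 0 < (32 * K) ^ τ⁻¹ := Real.rpow_pos_of_pos (by positivity) _
  have hS0 : 0 < S := hstar0.trans_le hlarge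
  -- `S^τ ≥ 32 K`
  have hSτ : 32 * K ≤ S ^ τ := by
    calc 32 * K = ((32 * K) ^ τ⁻¹) ^ τ := (Real.rpow_inv_rpow (by positivity) hτ.ne').symm
      _ ≤ S ^ τ := Real.rpow_le_rpow hstar0.le hlarge hτ.le
  -- `K S^{2-τ} ≤ S²/32`
  have hKS : K * S ^ (2 - τ) ≤ S ^ 2 / 32 := by
    rw [Real.rpow_sub hS0, Real.rpow_two]
    calc K * (S ^ 2 / S ^ τ) ≤ K * (S ^ 2 / (32 * K)) := by
          gcongr
      _ = S ^ 2 / 32 := by field_simp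
  -- `|E| ≤ S/8`
  have hE : Real.sqrt (G.tracelessRicciNormSq x) ≤ S / 8 := by
    rw [Real.sqrt_le_iff]
    refine ⟨by positivity, ?_⟩
    nlinarith [G.weylNormSq_nonneg x, hpin, hKS]
  have h0 : 0 ≤ G.val x w w := by
    by_cases hw : w = 0
    · simp [hw]
    · exact (hG x w hw).le
  have h := sub_sqrt_mul_val_le_ricci G hG x w
  rw [finrank_euclideanFour] at h
  push_cast at h
  calc 1 / 8 * S * G.val x w w ≤ (S / 4 - Real.sqrt (G.tracelessRicciNormSq x)) * G.val x w w := by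
        apply mul_le_mul_of_nonneg_right _ h0
        linarith
    _ ≤ G.ricci x w w := h

/-- **Pinching bounds `|Rm|²` by the scalar curvature**: `|Rm|² = |W|² + 2|E|² + R²/6`
(`curvNormSqWith_eq_weyl_add_traceless_add`) `≤ K R^{2−τ} + R²/6 ≤ (K + 1/6) R² + K`, since
`R^{2−τ} ≤ R² + 1` for `R > 0`, `0 ≤ 2 − τ ≤ 2`. [cite: Hamilton1986, §5, p. 163] -/
theorem curvNormSqWith_le_of_pinching
    (G : PseudoRiemannianMetric (𝓡 4) ∞ (EuclideanSpace ℝ (Fin 4)) (TangentSpace (𝓡 4) : M → Type _))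
    [G.HasLeviCivita] (hG : G.IsRiemannian) {K τ : ℝ} (hK : 0 ≤ K) (hτ : 0 ≤ τ) (hτ2 : τ ≤ 2)
    {x : M} (hS0 : 0 < G.scalarCurvature x)
    (hpin : G.weylNormSq x + 2 * G.tracelessRicciNormSq x ≤ K * G.scalarCurvature x ^ (2 - τ)) :
    G.curvNormSqWith G.leviCivita x ≤ (K + 1 / 6) * G.scalarCurvature x ^ 2 + K := by
  set S := G.scalarCurvature x with hS
  have hpow : S ^ (2 - τ) ≤ S ^ 2 + 1 := by
    rcases le_or_gt 1 S with h1 | h1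
    · calc S ^ (2 - τ) ≤ S ^ (2 : ℝ) := Real.rpow_le_rpow_of_exponent_le h1 (by linarith)
        _ = S ^ 2 := Real.rpow_two S
        _ ≤ S ^ 2 + 1 := by linarith
    · calc S ^ (2 - τ) ≤ 1 := Real.rpow_le_one hS0.le h1.le (by linarith)
        _ ≤ S ^ 2 + 1 := by nlinarith
  rw [curvNormSqWith_eq_weyl_add_traceless_add G hG x]
  nlinarith [mul_le_mul_of_nonneg_left hpow hK]

variable [CompactSpace M]
  {g : ℝ → PseudoRiemannianMetric (𝓡 4) ∞ (EuclideanSpace ℝ (Fin 4)) (TangentSpace (𝓡 4) : M → Type _)}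
  {cov : ℝ → CovariantDerivative (𝓡 4) (EuclideanSpace ℝ (Fin 4)) (TangentSpace (𝓡 4) : M → Type _)}
  {T : ℝ}

/-- **`R(·, t)` attains its maximum** on the compact nonempty manifold (it is `C^∞`,
`IsLeviCivita.contMDiff_trace_ricci`). [folklore] -/
theorem exists_isMax_scalarCurvatureWith [Nonempty M] {t : ℝ} (hLC : (g t).IsLeviCivita (cov t)) :
    ∃ xm : M, ∀ y : M, (g t).scalarCurvatureWith (cov t) y ≤ (g t).scalarCurvatureWith (cov t) xm := by
  have hcont : Continuous fun y ↦ (g t).scalarCurvatureWith (cov t) y :=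
    hLC.contMDiff_trace_ricci.continuous
  obtain ⟨xm, -, hxm⟩ := isCompact_univ.exists_isMaxOn univ_nonempty hcont.continuousOn
  exact ⟨xm, fun y ↦ hxm (mem_univ y)⟩

variable [T2Space M] [SecondCountableTopology M]

/-- **`R_max(t) → ∞` as `t → T` for a pinched maximal flow** (Hamilton 1982, Thm. 14.1 / Topping
2006, Thm. 5.3.1, in the liminf sense): for every level `L` there is `t₀ < T` such that at every
`t ∈ [t₀, T)` the scalar curvature exceeds `L` somewhere. The curvature blow-up (tree theorem
`ricciFlow_curvature_blowup_of_shortTime ricciFlow_shortTime_existence_holds`) denies the frame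
bound `√c`, `c = (K + 1/6) L² + K`, at all late times; were `R ≤ L` everywhere at such a time,
`|Rm|² ≤ c` (`curvNormSqWith_le_of_pinching`) would give that frame bound
(`curvatureBoundedBy_of_curvNormSqWith_le`). [cite: Hamilton1982, §14, Thm. 14.1] [cite: Topping2006, Thm. 5.3.1] -/
theorem exists_lt_scalarCurvatureWith (hmax : IsMaximalRicciFlow g cov T) {m K τ : ℝ} (hm : 0 < m)
    (hK : 0 < K) (hτ : 0 < τ) (hτ1 : τ ≤ 1)
    (hpinch : ∀ t ∈ Ico 0 T, ∀ [(g t).HasLeviCivita] (x : M),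
      m ≤ (g t).scalarCurvature x ∧
        (g t).weylNormSq x + 2 * (g t).tracelessRicciNormSq x ≤
          K * (g t).scalarCurvature x ^ (2 - τ))
    (L : ℝ) : ∃ t₀ ∈ Ico 0 T, ∀ t ∈ Ico t₀ T, ∃ x : M, L < (g t).scalarCurvatureWith (cov t) x := by
  have h2 : (2 : ℕ∞ω) ≤ ∞ := WithTop.coe_le_coe.mpr le_top
  set L' := max L 0 with hL'
  have hL'0 : 0 ≤ L' := le_max_right _ _
  set c : ℝ := (K + 1 / 6) * L' ^ 2 + K with hc
  obtain ⟨t₀, ht₀, hblow⟩ := ricciFlow_curvature_blowup_of_shortTime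
    ricciFlow_shortTime_existence_holds (𝓡 4) M T g cov hmax (Real.sqrt c)
  refine ⟨t₀, ht₀, fun t ht ↦ ?_⟩
  have ht' : t ∈ Ico 0 T := ⟨ht₀.1.trans ht.1, ht.2⟩
  have hR := hmax.isRiemannian t ht'
  have hLC := hmax.isRicciFlow.isLeviCivita t ht'
  haveI := (g t).hasLeviCivita
  by_contra hcon
  push Not at hcon
  refine hblow t ht (curvatureBoundedBy_of_curvNormSqWith_le hR hLC fun x ↦ ?_)
  -- at `x`: `R ≤ L ≤ L'`, so `|Rm|² ≤ (K + 1/6) R² + K ≤ c`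
  have hscal : (g t).scalarCurvatureWith (cov t) x = (g t).scalarCurvature x := by
    show (g t).trace x ((cov t).ricci x) = (g t).trace x ((g t).ricci x)
    rw [hLC.ricci_eq_ricci h2 x]
  obtain ⟨hmS, hpin⟩ := hpinch t ht' x
  have hS0 : 0 < (g t).scalarCurvature x := hm.trans_le hmS
  have hSL : (g t).scalarCurvature x ≤ L' := (hscal ▸ hcon x).trans (le_max_left _ _)
  rw [(g t).curvNormSqWith_congr (hLC.curvature_eq_riemann h2 x)]
  calc (g t).curvNormSqWith (g t).leviCivita x
      ≤ (K + 1 / 6) * (g t).scalarCurvature x ^ 2 + K :=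
        curvNormSqWith_le_of_pinching (g t) hR hK.le hτ.le (by linarith) hS0 hpin
    _ ≤ (K + 1 / 6) * L' ^ 2 + K := by gcongr
    _ = c := rfl

end Four

/-! ## STUB 4.B2 -/

/-- **STUB 4.B2 — `R_max/R_min → 1` AS `t → T` (Hamilton 1982, Thm. 15.1; Huisken 1985, §4 end).** For
the maximal (finite-time) Ricci flow on a closed connected 4-manifold with the invariant pinching
`m ≤ R`, `|W|² + 2|E|² ≤ K R^{2−τ}` and the gradient estimate `∀ η > 0 ∃ C, |∇R|² ≤ η R³ + C`
(Hamilton 1982, Thm. 11.1): for every `θ ∈ (0, 1)` there is `t₀ < T` with `θ R(y, t) ≤ R(x, t)` for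
all `x, y` and all `t ∈ [t₀, T)`. Proof: `R_max(t) → ∞` (`exists_lt_scalarCurvatureWith`, curvature
blow-up), `Rc ≥ (R/8) g` where `R ≥ R_*` (`ricci_ge_of_pinching`), and Hamilton's geometric step
with localised Ricci hypothesis (`helper_curvatureRatio_localMyers`, Aux file) at the maximum point
of `R(·, t)` with `η' = min (1−θ) (1/30)`,
`η = η'⁴/2`, at times so late that `η R_max³ + C ≤ η'⁴ R_max³` and `(1 − η') R_max ≥ R_*`.
Registered stub of the skeleton `Cruxes/ChangGurskyYang/Lines/margerin_cone_hamilton_rails.lean`,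
statement verbatim. [cite: Hamilton1982, §15, Thm. 15.1 and Thm. 15.2] [cite: Huisken1985, §4, p. 61] -/
theorem stub_curvatureRatio :
    ∀ (M : Type) [TopologicalSpace M] [T2Space M] [SecondCountableTopology M]
      [ChartedSpace (EuclideanSpace ℝ (Fin 4)) M] [IsManifold (𝓡 4) ∞ M] [CompactSpace M]
      [ConnectedSpace M]
      (g : ℝ → PseudoRiemannianMetric (𝓡 4) ∞ (EuclideanSpace ℝ (Fin 4)) (TangentSpace (𝓡 4) : M → Type _))
      (cov : ℝ → CovariantDerivative (𝓡 4) (EuclideanSpace ℝ (Fin 4)) (TangentSpace (𝓡 4) : M → Type _))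
      (T m K τ : ℝ), 0 < m → 0 < K → 0 < τ → τ ≤ 1 →
      IsMaximalRicciFlow g cov T →
      (∀ t ∈ Ico 0 T, ∀ [(g t).HasLeviCivita] (x : M),
        m ≤ (g t).scalarCurvature x ∧
          (g t).weylNormSq x + 2 * (g t).tracelessRicciNormSq x ≤
            K * (g t).scalarCurvature x ^ (2 - τ)) →
      (∀ η : ℝ, 0 < η → ∃ C : ℝ, ∀ t ∈ Ico 0 T, ∀ x : M,
        (g t).gradSq (fun y ↦ (g t).scalarCurvatureWith (cov t) y) x ≤
          η * (g t).scalarCurvatureWith (cov t) x ^ 3 + C) →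
      ∀ θ : ℝ, 0 < θ → θ < 1 → ∃ t₀ ∈ Ico 0 T, ∀ t ∈ Ico t₀ T, ∀ x y : M,
        θ * (g t).scalarCurvatureWith (cov t) y ≤ (g t).scalarCurvatureWith (cov t) x := by
  intro M _ _ _ _ _ _ _ g cov T m K τ hm hK hτ0 hτ1 hmax hpinch hgrad θ hθ hθ1
  have h2 : (2 : ℕ∞ω) ≤ ∞ := WithTop.coe_le_coe.mpr le_top
  -- the constants `η'`, `η = η'⁴/2`, `R_*`, and the level `L`
  set η' : ℝ := min (1 - θ) (1 / 30) with hη'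
  have hη'0 : 0 < η' := lt_min (by linarith) (by norm_num)
  have hη'θ : η' ≤ 1 - θ := min_le_left _ _
  have hη'30 : η' ≤ 1 / 30 := min_le_right _ _
  have hη'1 : η' < 1 := by linarith
  have h1η : 0 < 1 - η' := by linarith
  have hsmall : Real.pi ^ 2 * 3 * η' ^ 2 < 1 / 8 * (1 - η') := by
    have hπ := Real.pi_lt_four
    have hπ0 := Real.pi_pos
    have hη'sq : η' ^ 2 ≤ (1 / 30) ^ 2 := pow_le_pow_left₀ hη'0.le hη'30 2
    have hπsq : Real.pi ^ 2 < 4 ^ 2 := pow_lt_pow_left₀ hπ hπ0.le two_ne_zero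
    nlinarith
  obtain ⟨C, hC⟩ := hgrad (η' ^ 4 / 2) (by positivity)
  set Rstar : ℝ := (32 * K) ^ τ⁻¹ with hRstar
  have hRstar0 : 0 < Rstar := Real.rpow_pos_of_pos (by positivity) _
  set L : ℝ := 1 + (2 * |C| / η' ^ 4 + 1) + Rstar / (1 - η') with hL
  have hLa : 0 ≤ 2 * |C| / η' ^ 4 := by positivity
  have hLb : 0 ≤ Rstar / (1 - η') := by positivity
  have hL1 : 1 ≤ L := by rw [hL]; linarith
  have hLC : 2 * |C| ≤ η' ^ 4 * L := by
    have h1 : 2 * |C| / η' ^ 4 ≤ L := by rw [hL]; linarith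
    rw [div_le_iff₀ (by positivity)] at h1
    linarith
  have hLstar : Rstar ≤ (1 - η') * L := by
    have h1 : Rstar / (1 - η') ≤ L := by rw [hL]; linarith
    rw [div_le_iff₀ h1η] at h1
    linarith
  -- late times at which `R` exceeds `L` somewhere
  obtain ⟨t₀, ht₀, hlarge⟩ := exists_lt_scalarCurvatureWith hmax hm hK hτ0 hτ1 hpinch L
  refine ⟨t₀, ht₀, fun t ht x y ↦ ?_⟩
  have ht' : t ∈ Ico 0 T := ⟨ht₀.1.trans ht.1, ht.2⟩
  have hRiem := hmax.isRiemannian t ht'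
  have hLCt := hmax.isRicciFlow.isLeviCivita t ht'
  haveI := (g t).hasLeviCivita
  -- dictionary at time `t`
  have hscal : ∀ z : M, (g t).scalarCurvatureWith (cov t) z = (g t).scalarCurvature z := by
    intro z
    show (g t).trace z ((cov t).ricci z) = (g t).trace z ((g t).ricci z)
    rw [hLCt.ricci_eq_ricci h2 z]
  set R : M → ℝ := fun z ↦ (g t).scalarCurvatureWith (cov t) z with hRdef
  have hRm : ∀ z, m ≤ R z := fun z ↦ by
    show m ≤ (g t).scalarCurvatureWith (cov t) z
    rw [hscal z]
    exact (hpinch t ht' z).1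
  have hRpos : ∀ z, 0 < R z := fun z ↦ hm.trans_le (hRm z)
  -- the maximum point `xm` of `R(·, t)`; `R xm > L`
  obtain ⟨xm, hxm⟩ : ∃ xm : M, ∀ z, R z ≤ R xm := exists_isMax_scalarCurvatureWith hLCt
  obtain ⟨x₀, hx₀⟩ := hlarge t ht
  have hLR : L < R xm := hx₀.trans_le (hxm x₀)
  have hpos : 0 < R xm := hRpos xm
  have hR3 : R xm ≤ R xm ^ 3 := by
    have h1 : 1 ≤ R xm := hL1.trans hLR.le
    simpa using pow_le_pow_right₀ h1 (show 1 ≤ 3 by norm_num)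
  -- differentiability of `R`
  have hRdiff : ∀ z, MDifferentiableAt (𝓡 4) 𝓘(ℝ, ℝ) R z := fun z ↦
    hLCt.contMDiff_trace_ricci.mdifferentiableAt (by simp)
  -- the gradient bound `|dR(w)| ≤ η'² R_max^{3/2} |w|`
  have hA0 : 0 ≤ η' ^ 2 * (R xm * Real.sqrt (R xm)) := by positivity
  have hAsq : (η' ^ 2 * (R xm * Real.sqrt (R xm))) ^ 2 = η' ^ 4 * R xm ^ 3 := by
    rw [mul_pow, mul_pow, Real.sq_sqrt hpos.le]
    ring
  have hgrad' : ∀ (z : M) (w : TangentSpace (𝓡 4) z),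
      |mvfderiv (𝓡 4) R z w| ≤ η' ^ 2 * (R xm * Real.sqrt (R xm)) * Real.sqrt ((g t).val z w w) := by
    intro z w
    have h1 := abs_mvfderiv_le_sqrt_gradSq_mul_sqrt (g t) hRiem R z w
    have h2 : (g t).gradSq R z ≤ η' ^ 4 * R xm ^ 3 := by
      have h3 : (g t).gradSq R z ≤ η' ^ 4 / 2 * R z ^ 3 + C := hC t ht' z
      have h4 : R z ^ 3 ≤ R xm ^ 3 := pow_le_pow_left₀ (hRpos z).le (hxm z) 3
      have h5 : C ≤ η' ^ 4 / 2 * R xm ^ 3 := by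
        have h6 : η' ^ 4 * L ≤ η' ^ 4 * R xm ^ 3 :=
          mul_le_mul_of_nonneg_left (hLR.le.trans hR3) (by positivity)
        linarith [le_abs_self C]
      have h7 : η' ^ 4 / 2 * R z ^ 3 ≤ η' ^ 4 / 2 * R xm ^ 3 :=
        mul_le_mul_of_nonneg_left h4 (by positivity)
      linarith
    have h3 : Real.sqrt ((g t).gradSq R z) ≤ η' ^ 2 * (R xm * Real.sqrt (R xm)) := by
      rw [← Real.sqrt_sq hA0, hAsq]
      exact Real.sqrt_le_sqrt h2
    exact h1.trans (mul_le_mul_of_nonneg_right h3 (Real.sqrt_nonneg _))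
  -- the localised Ricci bound `Rc ≥ (R/8) g` where `R ≥ (1 - η') R_max (≥ R_*)`
  have hRic' : ∀ (z : M) (w : TangentSpace (𝓡 4) z), (1 - η') * R xm ≤ R z →
      1 / 8 * R z * (g t).val z w w ≤ (g t).ricci z w w := by
    intro z w hz
    have hzstar : Rstar ≤ (g t).scalarCurvature z := by
      rw [← hscal z]
      have h1 : (1 - η') * L ≤ (1 - η') * R xm := mul_le_mul_of_nonneg_left hLR.le h1η.le
      exact hLstar.trans (h1.trans hz)
    have h := ricci_ge_of_pinching (g t) hRiem hK hτ0 (hpinch t ht' z).2 hzstar w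
    rw [← hscal z] at h
    exact h
  -- Hamilton's geometric step at the maximum point
  have key : (1 - η') * R xm ≤ R x :=
    helper_curvatureRatio_localMyers M (g t) hRiem R xm η' (1 / 8) hRdiff hpos hη'0 hη'1
      (by norm_num) hsmall hgrad' hRic' x
  calc θ * R y ≤ θ * R xm := mul_le_mul_of_nonneg_left (hxm y) hθ.le
    _ ≤ (1 - η') * R xm := mul_le_mul_of_nonneg_right (by linarith) hpos.le
    _ ≤ R x := key

end Summit.SmoothPoincare4.SmoothPoincare4.Theorems.MargerinRails

end
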